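import Literature.AlgebraicGeometry.Resolution.BlowupAlgebraFlatBaseChange
import Mathlib.RingTheory.Flat.FaithfullyFlat.Algebra
import Mathlib.RingTheory.RingHom.Flat
import Mathlib.RingTheory.Localization.AtPrime.Basic
import Mathlib.RingTheory.LocalRing.ResidueField.Basic
import HarnessLib

/-!
# [OURS · L1 W4.2] D18 (P2b-glue), RING LEVEL: a formally-étale-neighbourhood presentation `A → B` persists at every point of the
# blow-up, the point's local ring being READ ON THE CHART ALGEBRA `B[IB/a]` of the target
# (cell res-hironaka, LADDER-RESOLUTION rung L; slot W4.2, crux chain w42 `SigmaMaxModificationsCorridor3` stmt-ResolutionOfSingularities-19249;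
# `--supports stmt-ResolutionOfSingularities-19249 --as helper`; res-L1-w42-plan-1 GO F-74 12:34:43Z «successor gen 6 FIRST ITEM: (P2b-glue)»;
# hand res-D-brk-3 (gen 6), TAKING-UNLESS-OBJECTED 13:03:41Z)

PURE COMMUTATIVE ALGEBRA, 0 `def`s, every declaration PROVED; OURS bookkeeping; NOT a statement of Hironaka's manuscript [Hironaka2017] nor of
[CossartJannsenSaito2020]/[CossartPiltant2019]. AI-written, weaker than expert review.

SETTING. `A → B` a homomorphism of local rings which is FLAT, with `𝔪_A B = 𝔪_B` and `A → B/𝔪_B` onto — the three load-bearing clauses of a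
CP-frame presentation `φ : 𝒪_{X_n,x_n} → R[X]/(h)` (res-type-067's `IsCPFrame`, p515936). `I ⊆ A` any ideal (the stalk of the centre),
`a ∈ A` a chart denominator, `J = I·B`, `ψ : A[I/a] → B[J/a]` the map of affine blowup algebras (tree `blowupAlgebraMap`, image model
`A[I/a] ⊆ A[1/a]`, GW (13.19)). By the tree's `IsBlowup.exists_blowupAlgebra_stalk_ringEquiv` (Stacks 0804) the local ring of a point `x'`
of the blow-up over `x_n` IS `(A[I/c_j])_𝔔` for a prime `𝔔 ⊇ 𝔪_A` of a chart algebra; this file shows that the presentation follows it there: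

* `isLocalHom_of_map_maximalIdeal_eq`, `exists_sub_algebraMap_mem_maximalIdeal` — bookkeeping forms of the clauses.
* `faithfullyFlat_blowupAlgebraMap` — **`ψ` is FAITHFULLY flat**: `B[J/a] = A[I/a] ⊗_A B` (tree `exists_baseChange_linearEquiv`, Stacks 0805,
  as an `Algebra.IsPushout`) and `A → B` is faithfully flat (flat + local, Mathlib `Module.FaithfullyFlat.of_flat_of_isLocalHom`).
* `exists_sub_blowupAlgebraMap_mem` — APPROXIMATION: every element of `B[J/a]` is `ψ(r) + w`, `w ∈ 𝔪_A·B[J/a]` (tree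
  `exists_sub_mem_map_of_forall` with `𝔞 = 𝔪_B = 𝔪_A B`).
* `comap_map_blowupAlgebraMap`, `quotientMap_blowupAlgebraMap_bijective`, `isPrime_map_blowupAlgebraMap` — for a prime `𝔔 ⊇ 𝔪_A A[I/a]`:
  `𝔔' := 𝔔·B[J/a]` contracts to `𝔔` (faithful flatness), `A[I/a]/𝔔 → B[J/a]/𝔔'` is BIJECTIVE (approximation), hence `𝔔'` is PRIME;
  `eq_map_blowupAlgebraMap_of_comap_eq` — `𝔔'` is the ONLY ideal of `B[J/a]` contracting to `𝔔` (so the point of `Bl_J(Spec B)` over `x'` is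
  unique, with the same residue field); `comap_algebraMap_map_blowupAlgebraMap` — `𝔔' ∩ B = 𝔪_B` when `𝔔 ∩ A = 𝔪_A`.
* **`localRingHom_blowupAlgebraMap_presentation`** — THE GLUE: for any prime `𝔔'` of `B[J/a]` over `𝔔`, the induced local homomorphism
  `(A[I/a])_𝔔 → (B[J/a])_{𝔔'}` (Mathlib `Localization.localRingHom`) is FLAT (`RingHom.Flat.localRingHom` over the tree's
  `flat_blowupAlgebraMap`), maps `𝔪` ONTO `𝔪`, and is onto on residue fields — the presentation one blow-up up, at ring level, with the
  new local ring ALREADY a localisation of the chart algebra of `B` (no second blow-up `Bl ×_{X_n} Spec B` and no ideal-sheaf pull-back,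
  replacing that detour of res-D-pv-050's roadmap 11:33:09Z; the scheme reading with `IsBlowup.exists_blowupAlgebra_stalk_ringEquiv` and the
  chart change to a `u_{j₀}`-chart of the hypersurface `R[X]/(h)` (p526498 `exists_monic_transform_ringEquiv`) are the next files).

References: The Stacks Project, Tags 0804, 0805 [StacksProject]; Görtz–Wedhorn I (13.19), Prop. 13.91 [GortzWedhorn2020]; Matsumura, Thm. 7.2/7.3
(faithful flatness) [Matsumura1987]; tree `Resolution/BlowupAlgebraFlatBaseChange`, `Resolution/BlowupStalkBlowupAlgebra`; HOME STATUS
res-L1-w42-plan-1 12:34:43Z, res-D-pv-050 11:33:09Z (D18 roadmap), res-D-brk-3 13:03:41Z (cut G1–G5).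
-/

noncomputable section

set_option linter.dupNamespace false

open IsLocalRing TensorProduct
open Literature.AlgebraicGeometry.Resolution
open Literature.AlgebraicGeometry.Resolution.BlowupAlgebraFlatBaseChange

universe u

namespace Summit.ResolutionOfSingularities.ResolutionOfSingularities.Theorems.SigmaMaxModificationsCorridor3.Helpers

variable {A B : Type u} [CommRing A] [CommRing B] [Algebra A B]

/-! ## The presentation clauses, bookkeeping forms -/

/-- `𝔪_A B = 𝔪_B` makes `A → B` a local homomorphism. [folklore] -/
theorem isLocalHom_of_map_maximalIdeal_eq [IsLocalRing A] [IsLocalRing B]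
    (hmax : (maximalIdeal A).map (algebraMap A B) = maximalIdeal B) : IsLocalHom (algebraMap A B) :=
  ((local_hom_TFAE (algebraMap A B)).out 0 2).mpr hmax.le

/-- `A → B/𝔪_B` onto, elementwise: every `b ∈ B` is `a₀ + w` with `w ∈ 𝔪_B`. [folklore] -/
theorem exists_sub_algebraMap_mem_maximalIdeal [IsLocalRing B]
    (hres : Function.Surjective ((residue B).comp (algebraMap A B))) (b : B) :
    ∃ a₀ : A, b - algebraMap A B a₀ ∈ maximalIdeal B := by
  obtain ⟨a₀, ha₀⟩ := hres (residue B b)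
  exact ⟨a₀, Ideal.Quotient.eq.mp ha₀.symm⟩

variable (I : Ideal A) (J : Ideal B) (a : A) (hIJ : I.map (algebraMap A B) ≤ J)

/-- The map of chart algebras `ψ : A[I/a] → B[J/a]` is compatible with the `A`-algebra structures. [folklore] -/
theorem isScalarTower_blowupAlgebraMap :
    letI := (blowupAlgebraMap (algebraMap A B) I J a hIJ).toAlgebra
    IsScalarTower A (blowupAlgebra I a) (blowupAlgebra J (algebraMap A B a)) := by
  letI := (blowupAlgebraMap (algebraMap A B) I J a hIJ).toAlgebra
  exact IsScalarTower.of_algebraMap_eq fun x => by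
    rw [RingHom.algebraMap_toAlgebra, blowupAlgebraMap_algebraMap, ← IsScalarTower.algebraMap_apply]

/-- [OURS · L1 W4.2] **`ψ : A[I/a] → B[J/a]` is FAITHFULLY FLAT** when `A → B` is a flat LOCAL homomorphism of local rings and `J = I·B`:
`B[J/a]` is the pushout `A[I/a] ⊗_A B` (tree `exists_baseChange_linearEquiv`, Stacks 0805, in Mathlib's `Algebra.IsPushout` form) of the
faithfully flat `A → B` (Mathlib `Module.FaithfullyFlat.of_flat_of_isLocalHom`), and faithful flatness is stable under base change.
[cite: StacksProject, Tag 0805] -/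
theorem faithfullyFlat_blowupAlgebraMap [IsLocalRing A] [IsLocalRing B] [Module.Flat A B] [IsLocalHom (algebraMap A B)]
    (hJI : J ≤ I.map (algebraMap A B)) :
    @Module.FaithfullyFlat (blowupAlgebra I a) (blowupAlgebra J (algebraMap A B a)) _ _
      (blowupAlgebraMap (algebraMap A B) I J a hIJ).toAlgebra.toModule := by
  letI := (blowupAlgebraMap (algebraMap A B) I J a hIJ).toAlgebra
  haveI := isScalarTower_blowupAlgebraMap I J a hIJ
  haveI : Module.FaithfullyFlat A B := Module.FaithfullyFlat.of_flat_of_isLocalHom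
  haveI hpo : Algebra.IsPushout A B (blowupAlgebra I a) (blowupAlgebra J (algebraMap A B a)) := by
    obtain ⟨e, he⟩ := exists_baseChange_linearEquiv I J a hIJ hJI
    refine ⟨IsBaseChange.of_equiv e fun r => ?_⟩
    rw [he, one_smul]
    rfl
  exact Module.FaithfullyFlat.of_linearEquiv (R := blowupAlgebra I a) (M := blowupAlgebra I a ⊗[A] B)
    (N := blowupAlgebra J (algebraMap A B a)) hpo.symm.out.equiv.symm

/-- [OURS · L1 W4.2] **APPROXIMATION along `ψ`**: with `𝔪_A B = 𝔪_B` and `A → B/𝔪_B` onto, every element of `B[J/a]` is `ψ(r) + w` with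
`w ∈ (𝔪_A A[I/a])·B[J/a]` (tree `exists_sub_mem_map_of_forall` with `𝔞 = 𝔪_B`). [cite: StacksProject, Tag 0805] -/
theorem exists_sub_blowupAlgebraMap_mem [IsLocalRing A] [IsLocalRing B] [Module.Flat A B]
    (hJI : J ≤ I.map (algebraMap A B)) (hmax : (maximalIdeal A).map (algebraMap A B) = maximalIdeal B)
    (hres : Function.Surjective ((residue B).comp (algebraMap A B))) (x : blowupAlgebra J (algebraMap A B a)) :
    ∃ r : blowupAlgebra I a, x - blowupAlgebraMap (algebraMap A B) I J a hIJ r ∈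
      ((maximalIdeal A).map (algebraMap A (blowupAlgebra I a))).map (blowupAlgebraMap (algebraMap A B) I J a hIJ) := by
  letI := (blowupAlgebraMap (algebraMap A B) I J a hIJ).toAlgebra
  haveI := isScalarTower_blowupAlgebraMap I J a hIJ
  obtain ⟨r, hr⟩ := exists_sub_mem_map_of_forall I J a hIJ hJI (maximalIdeal B)
    (exists_sub_algebraMap_mem_maximalIdeal hres) x
  refine ⟨r, ?_⟩
  have hmB : (maximalIdeal B).map (algebraMap B (blowupAlgebra J (algebraMap A B a))) =
      ((maximalIdeal A).map (algebraMap A (blowupAlgebra I a))).map (blowupAlgebraMap (algebraMap A B) I J a hIJ) := by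
    rw [← hmax, Ideal.map_map, Ideal.map_map, ← IsScalarTower.algebraMap_eq A B, ← RingHom.algebraMap_toAlgebra
      (blowupAlgebraMap (algebraMap A B) I J a hIJ), ← IsScalarTower.algebraMap_eq]
  rwa [hmB] at hr

/-! ## The prime `𝔔' = 𝔔·B[J/a]` over a prime `𝔔 ⊇ 𝔪_A` of `A[I/a]` -/

section Prime

variable [IsLocalRing A] [IsLocalRing B] [Module.Flat A B]

/-- [OURS · L1 W4.2] **`𝔔·B[J/a]` contracts to `𝔔`** (faithful flatness of `ψ`, Mathlib `Ideal.comap_map_eq_self_of_faithfullyFlat`).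
[cite: Matsumura1987, Thm. 7.5 (ii)] -/
theorem comap_map_blowupAlgebraMap (hJI : J ≤ I.map (algebraMap A B))
    (hmax : (maximalIdeal A).map (algebraMap A B) = maximalIdeal B) (𝔔 : Ideal (blowupAlgebra I a)) :
    (𝔔.map (blowupAlgebraMap (algebraMap A B) I J a hIJ)).comap (blowupAlgebraMap (algebraMap A B) I J a hIJ) = 𝔔 := by
  haveI := isLocalHom_of_map_maximalIdeal_eq hmax
  letI := (blowupAlgebraMap (algebraMap A B) I J a hIJ).toAlgebra
  haveI := faithfullyFlat_blowupAlgebraMap I J a hIJ hJI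
  exact Ideal.comap_map_eq_self_of_faithfullyFlat (A := blowupAlgebra I a) (B := blowupAlgebra J (algebraMap A B a)) 𝔔

/-- [OURS · L1 W4.2] **`𝔔·B[J/a]` is the ONLY ideal of `B[J/a]` contracting to `𝔔`**, for `𝔔 ⊇ 𝔪_A A[I/a]` (approximation: an element of
such an ideal is `ψ(r) + w` with `w ∈ 𝔪_A·B[J/a] ⊆ 𝔔·B[J/a]` and then `r ∈ 𝔔`). In particular the point of `Bl_J(Spec B)` over a point of
`Bl_I(Spec A)` over the closed point is unique. [folklore] -/
theorem eq_map_blowupAlgebraMap_of_comap_eq (hJI : J ≤ I.map (algebraMap A B))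
    (hmax : (maximalIdeal A).map (algebraMap A B) = maximalIdeal B)
    (hres : Function.Surjective ((residue B).comp (algebraMap A B))) (𝔔 : Ideal (blowupAlgebra I a))
    (h𝔔 : (maximalIdeal A).map (algebraMap A (blowupAlgebra I a)) ≤ 𝔔)
    (𝔔'' : Ideal (blowupAlgebra J (algebraMap A B a)))
    (h : 𝔔''.comap (blowupAlgebraMap (algebraMap A B) I J a hIJ) = 𝔔) :
    𝔔'' = 𝔔.map (blowupAlgebraMap (algebraMap A B) I J a hIJ) := by
  have hle : 𝔔.map (blowupAlgebraMap (algebraMap A B) I J a hIJ) ≤ 𝔔'' := Ideal.map_le_iff_le_comap.mpr h.ge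
  refine le_antisymm (fun x hx => ?_) hle
  obtain ⟨r, hr⟩ := exists_sub_blowupAlgebraMap_mem I J a hIJ hJI hmax hres x
  have hw : x - blowupAlgebraMap (algebraMap A B) I J a hIJ r ∈ 𝔔.map (blowupAlgebraMap (algebraMap A B) I J a hIJ) :=
    Ideal.map_mono h𝔔 hr
  have hψr : blowupAlgebraMap (algebraMap A B) I J a hIJ r ∈ 𝔔'' := by
    have := 𝔔''.sub_mem hx (hle hw)
    rwa [sub_sub_cancel] at this
  have hr𝔔 : r ∈ 𝔔 := by
    rw [← h]
    exact Ideal.mem_comap.mpr hψr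
  have := add_mem hw (Ideal.mem_map_of_mem (blowupAlgebraMap (algebraMap A B) I J a hIJ) hr𝔔)
  rwa [sub_add_cancel] at this

/-- [OURS · L1 W4.2] **`A[I/a]/𝔔 → B[J/a]/𝔔·B[J/a]` is BIJECTIVE** for `𝔔 ⊇ 𝔪_A A[I/a]`: injective by `comap_map_blowupAlgebraMap`, onto by
the approximation (`𝔪_A·B[J/a] ⊆ 𝔔·B[J/a]`) — the two exceptional fibres have the same coordinate rings at corresponding points, and the
same residue fields. [folklore] -/
theorem quotientMap_blowupAlgebraMap_bijective (hJI : J ≤ I.map (algebraMap A B))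
    (hmax : (maximalIdeal A).map (algebraMap A B) = maximalIdeal B)
    (hres : Function.Surjective ((residue B).comp (algebraMap A B))) (𝔔 : Ideal (blowupAlgebra I a))
    (h𝔔 : (maximalIdeal A).map (algebraMap A (blowupAlgebra I a)) ≤ 𝔔) :
    Function.Bijective (Ideal.quotientMap (𝔔.map (blowupAlgebraMap (algebraMap A B) I J a hIJ))
      (blowupAlgebraMap (algebraMap A B) I J a hIJ) Ideal.le_comap_map) := by
  refine ⟨Ideal.quotientMap_injective' (comap_map_blowupAlgebraMap I J a hIJ hJI hmax 𝔔).le, fun y => ?_⟩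
  obtain ⟨x, rfl⟩ := Ideal.Quotient.mk_surjective y
  obtain ⟨r, hr⟩ := exists_sub_blowupAlgebraMap_mem I J a hIJ hJI hmax hres x
  refine ⟨Ideal.Quotient.mk 𝔔 r, ?_⟩
  rw [Ideal.quotientMap_mk, Ideal.Quotient.eq]
  have hw : x - blowupAlgebraMap (algebraMap A B) I J a hIJ r ∈ 𝔔.map (blowupAlgebraMap (algebraMap A B) I J a hIJ) :=
    Ideal.map_mono h𝔔 hr
  rw [← Ideal.neg_mem_iff, neg_sub]
  exact hw

/-- [OURS · L1 W4.2] **`𝔔' = 𝔔·B[J/a]` is PRIME** for a prime `𝔔 ⊇ 𝔪_A A[I/a]` (its quotient is `A[I/a]/𝔔`, a domain), and contracts to `𝔔`.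
[folklore] -/
theorem isPrime_map_blowupAlgebraMap (hJI : J ≤ I.map (algebraMap A B))
    (hmax : (maximalIdeal A).map (algebraMap A B) = maximalIdeal B)
    (hres : Function.Surjective ((residue B).comp (algebraMap A B))) (𝔔 : Ideal (blowupAlgebra I a)) [𝔔.IsPrime]
    (h𝔔 : (maximalIdeal A).map (algebraMap A (blowupAlgebra I a)) ≤ 𝔔) :
    (𝔔.map (blowupAlgebraMap (algebraMap A B) I J a hIJ)).IsPrime := by
  have hbij := quotientMap_blowupAlgebraMap_bijective I J a hIJ hJI hmax hres 𝔔 h𝔔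
  let e := RingEquiv.ofBijective _ hbij
  haveI : IsDomain (blowupAlgebra I a ⧸ 𝔔) := (Ideal.Quotient.isDomain_iff_prime _).mpr ‹_›
  haveI : IsDomain (blowupAlgebra J (algebraMap A B a) ⧸ 𝔔.map (blowupAlgebraMap (algebraMap A B) I J a hIJ)) :=
    e.symm.toMulEquiv.isDomain (blowupAlgebra I a ⧸ 𝔔)
  exact (Ideal.Quotient.isDomain_iff_prime _).mp inferInstance

/-- [OURS · L1 W4.2] **`𝔔' ∩ B = 𝔪_B` when `𝔔 ∩ A = 𝔪_A`**: the point of `Bl_J(Spec B)` lies over the closed point. [folklore] -/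
theorem comap_algebraMap_map_blowupAlgebraMap (hJI : J ≤ I.map (algebraMap A B))
    (hmax : (maximalIdeal A).map (algebraMap A B) = maximalIdeal B)
    (hres : Function.Surjective ((residue B).comp (algebraMap A B))) (𝔔 : Ideal (blowupAlgebra I a)) [𝔔.IsPrime]
    (h𝔔 : 𝔔.comap (algebraMap A (blowupAlgebra I a)) = maximalIdeal A) :
    (𝔔.map (blowupAlgebraMap (algebraMap A B) I J a hIJ)).comap (algebraMap B (blowupAlgebra J (algebraMap A B a))) =
      maximalIdeal B := by
  have h𝔔' : (maximalIdeal A).map (algebraMap A (blowupAlgebra I a)) ≤ 𝔔 := Ideal.map_le_iff_le_comap.mpr h𝔔.ge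
  haveI := isPrime_map_blowupAlgebraMap I J a hIJ hJI hmax hres 𝔔 h𝔔'
  letI := (blowupAlgebraMap (algebraMap A B) I J a hIJ).toAlgebra
  haveI := isScalarTower_blowupAlgebraMap I J a hIJ
  symm
  refine (maximalIdeal.isMaximal B).eq_of_le (Ideal.comap_ne_top _ (Ideal.IsPrime.ne_top ‹_›)) ?_
  refine Ideal.map_le_iff_le_comap.mp ?_
  rw [← hmax, Ideal.map_map, ← IsScalarTower.algebraMap_eq A B,
    IsScalarTower.algebraMap_eq A (blowupAlgebra I a) (blowupAlgebra J (algebraMap A B a)), ← Ideal.map_map,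
    RingHom.algebraMap_toAlgebra]
  exact Ideal.map_mono h𝔔'

end Prime

/-! ## The glue: the presentation at the localisations -/

/-- [OURS · L1 W4.2] **D18 (P2b-glue), ring level — a formally-étale-neighbourhood presentation persists at the points of the blow-up, on
the chart algebra of the target.** Let `A → B` be a FLAT homomorphism of local rings with `𝔪_A B = 𝔪_B` and `A → B/𝔪_B` onto (the clauses of
`IsCPFrame`), `I ⊆ A`, `a ∈ A`, `J = I·B`, `ψ : A[I/a] → B[J/a]`. For every prime `𝔔 ⊇ 𝔪_A` of `A[I/a]` (the local ring `(A[I/a])_𝔔` of a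
point of `Bl_I` over the closed point, tree `IsBlowup.exists_blowupAlgebra_stalk_ringEquiv`) and every prime `𝔔'` of `B[J/a]` contracting to
`𝔔` (there is exactly one, `𝔔·B[J/a]`: `isPrime_map_blowupAlgebraMap`, `eq_map_blowupAlgebraMap_of_comap_eq`), the induced local homomorphism
`ψ_𝔔 : (A[I/a])_𝔔 → (B[J/a])_{𝔔'}` is FLAT, maps `𝔪` ONTO `𝔪`, and is onto on residue fields. [cite: StacksProject, Tag 0805] -/
theorem localRingHom_blowupAlgebraMap_presentation [IsLocalRing A] [IsLocalRing B] [Module.Flat A B]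
    (hJI : J ≤ I.map (algebraMap A B)) (hmax : (maximalIdeal A).map (algebraMap A B) = maximalIdeal B)
    (hres : Function.Surjective ((residue B).comp (algebraMap A B)))
    (𝔔 : Ideal (blowupAlgebra I a)) [𝔔.IsPrime] (h𝔔 : (maximalIdeal A).map (algebraMap A (blowupAlgebra I a)) ≤ 𝔔)
    (𝔔' : Ideal (blowupAlgebra J (algebraMap A B a))) [𝔔'.IsPrime]
    (h𝔔' : 𝔔'.comap (blowupAlgebraMap (algebraMap A B) I J a hIJ) = 𝔔) :
    @RingHom.Flat (Localization.AtPrime 𝔔) (Localization.AtPrime 𝔔') _ _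
        (Localization.localRingHom 𝔔 𝔔' (blowupAlgebraMap (algebraMap A B) I J a hIJ) h𝔔'.symm) ∧
      IsLocalHom (Localization.localRingHom 𝔔 𝔔' (blowupAlgebraMap (algebraMap A B) I J a hIJ) h𝔔'.symm) ∧
      (maximalIdeal (Localization.AtPrime 𝔔)).map
          (Localization.localRingHom 𝔔 𝔔' (blowupAlgebraMap (algebraMap A B) I J a hIJ) h𝔔'.symm) =
        maximalIdeal (Localization.AtPrime 𝔔') ∧
      Function.Surjective ((residue (Localization.AtPrime 𝔔')).comp
        (Localization.localRingHom 𝔔 𝔔' (blowupAlgebraMap (algebraMap A B) I J a hIJ) h𝔔'.symm)) := by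
  set ψ := blowupAlgebraMap (algebraMap A B) I J a hIJ with hψ
  -- `𝔔'` is the extended ideal
  have h𝔔'eq : 𝔔' = 𝔔.map ψ := eq_map_blowupAlgebraMap_of_comap_eq I J a hIJ hJI hmax hres 𝔔 h𝔔 𝔔' h𝔔'
  have hψmem : ∀ r, ψ r ∈ 𝔔' ↔ r ∈ 𝔔 := fun r => by rw [← h𝔔', Ideal.mem_comap]
  refine ⟨?_, inferInstance, ?_, ?_⟩
  · -- flatness: localisation of the flat `ψ`
    exact RingHom.Flat.localRingHom (flat_blowupAlgebraMap I J a hIJ hJI) 𝔔' 𝔔 h𝔔'.symm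
  · -- `𝔪 ↦ 𝔪` onto
    have hcomp : (algebraMap (blowupAlgebra J (algebraMap A B a)) (Localization.AtPrime 𝔔')).comp ψ =
        (Localization.localRingHom 𝔔 𝔔' ψ h𝔔'.symm).comp (algebraMap (blowupAlgebra I a) (Localization.AtPrime 𝔔)) :=
      RingHom.ext fun x => (Localization.localRingHom_to_map 𝔔 𝔔' ψ h𝔔'.symm x).symm
    have h1 : maximalIdeal (Localization.AtPrime 𝔔') =
        (𝔔.map ψ).map (algebraMap (blowupAlgebra J (algebraMap A B a)) (Localization.AtPrime 𝔔')) := by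
      rw [← h𝔔'eq]
      exact Localization.AtPrime.map_eq_maximalIdeal.symm
    rw [h1, ← Localization.AtPrime.map_eq_maximalIdeal (I := 𝔔), Ideal.map_map, Ideal.map_map, hcomp]
  · -- residue fields: `κ(𝔔) → κ(𝔔')` onto
    intro ρ
    obtain ⟨w, rfl⟩ := residue_surjective ρ
    obtain ⟨⟨x, s⟩, rfl⟩ := IsLocalization.mk'_surjective 𝔔'.primeCompl w
    obtain ⟨r, hr⟩ := exists_sub_blowupAlgebraMap_mem I J a hIJ hJI hmax hres x
    obtain ⟨t, ht⟩ := exists_sub_blowupAlgebraMap_mem I J a hIJ hJI hmax hres (s : blowupAlgebra J (algebraMap A B a))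
    have hle' : 𝔔.map ψ ≤ 𝔔' := le_of_eq h𝔔'eq.symm
    have hr' : x - ψ r ∈ 𝔔' := hle' (Ideal.map_mono h𝔔 hr)
    have ht' : (s : blowupAlgebra J (algebraMap A B a)) - ψ t ∈ 𝔔' := hle' (Ideal.map_mono h𝔔 ht)
    have ht𝔔 : t ∈ 𝔔.primeCompl := by
      intro ht𝔔
      apply s.2
      have := add_mem ht' ((hψmem t).mpr ht𝔔)
      rwa [sub_add_cancel] at this
    have hψt : ψ t ∈ 𝔔'.primeCompl := fun h => ht𝔔 ((hψmem t).mp h)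
    refine ⟨IsLocalization.mk' (Localization.AtPrime 𝔔) r ⟨t, ht𝔔⟩, ?_⟩
    rw [RingHom.comp_apply, Localization.localRingHom_mk']
    apply Ideal.Quotient.eq.mpr
    change IsLocalization.mk' (Localization.AtPrime 𝔔') (ψ r) (⟨ψ t, hψt⟩ : 𝔔'.primeCompl) -
        IsLocalization.mk' (Localization.AtPrime 𝔔') x s ∈ maximalIdeal (Localization.AtPrime 𝔔')
    have key : IsLocalization.mk' (Localization.AtPrime 𝔔') (ψ r) (⟨ψ t, hψt⟩ : 𝔔'.primeCompl) -
        IsLocalization.mk' (Localization.AtPrime 𝔔') x s =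
        IsLocalization.mk' (Localization.AtPrime 𝔔') (ψ r * (s : blowupAlgebra J (algebraMap A B a)) - x * ψ t)
          ((⟨ψ t, hψt⟩ : 𝔔'.primeCompl) * s) :=
      (IsLocalization.mk'_sub (Localization.AtPrime 𝔔') (ψ r) x (⟨ψ t, hψt⟩ : 𝔔'.primeCompl) s).symm
    rw [key]
    refine (IsLocalization.AtPrime.mk'_mem_maximal_iff (Localization.AtPrime 𝔔') 𝔔' _ _).mpr ?_
    have : ψ r * (s : blowupAlgebra J (algebraMap A B a)) - x * ψ t =
        ψ r * ((s : blowupAlgebra J (algebraMap A B a)) - ψ t) - (x - ψ r) * ψ t := by ring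
    rw [this]
    exact sub_mem (Ideal.mul_mem_left _ _ ht') (Ideal.mul_mem_right _ _ hr')

end Summit.ResolutionOfSingularities.ResolutionOfSingularities.Theorems.SigmaMaxModificationsCorridor3.Helpers

end
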